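import Mathlib
import Summits.MatrixMultiplication.MatrixMultiplication.Theorems.LevelGradedCohnUmansSepImpliesTPP
import Summits.MatrixMultiplication.MatrixMultiplication.Theorems.GradedDesignFamily.Negative.SubfieldCellConfinement
import Summits.MatrixMultiplication.MatrixMultiplication.Theorems.GradedDesignFamily.Negative.SubfieldCellCeiling

/-!
# The footprint reduction of S3: a balanced S3 design has footprint `|φ(SL₂ k)·Y·Y⁻¹·Z| = O(|K|³/c²)`,
# so S3 is refuted by any FOOTPRINT-EXPANSION theorem for TPP triples in `GL₂`
# (crux `LevelGradedCohnUmans.GradedDesignFamily`, stmt-MatrixMultiplication-7610; negative side,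
# line `quadratic-extension-level-one-cell`, unit b2b-lgcu-subfield gen 18)

HONEST FRAMING.  This file is a REDUCTION, kernel-checked, of the open design stub S3
(`stub_subfieldCell`) to a pure statement about product sets in `GL₂` of a finite field; it does NOT
decide S3 and is NOT summit progress (a negative decision of S3 retires the line, the opposite of
progress towards `ω = 2`).

Write `H := φ(SL₂ k) ⊆ GL₂(K)` (`φ` injective, `|K| = |k|²`, `Q := |K|`), and let `(Y, Z)` satisfy S3's
separation clause verbatim with `|H|, |Y|, |Z| ≥ c·Q^{3/2}`, `0 < c ≤ 1`.

* `subfieldCell_tpp` — the separation clause gives the triple product property of `(H, Y, Z)`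
  (one-subgroup identity test `SubfieldCell.frameSeparated_image` + the route item `SepImpliesTPP`).
* `subfieldCell_footprint_subset` — the FOOTPRINT `H·Y·Y⁻¹·Z` is contained in the garbage
  `Γ = H·(YY⁻¹∖1)·Z` together with `H·Z`.
* `subfieldCell_footprint_card_le` — for `Q ≥ 4/c²`: `|H·Y·Y⁻¹·Z| ≤ (10/c²)·Q³`.  (The lead's garbage
  confinement `subfieldCell_confinement` gives `|Γ| ≤ 8Q³/c²` once `|H||Z| ≥ c²Q³`, and the standing
  ceiling `subfieldCell_ceiling` gives `|H·Z| ≤ |H||Z| ≤ Q³ + Q²`.)  Since `|H·Y| = |H||Y| ≥ c²Q³` and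
  `|Y⁻¹·Z| = |Y||Z| ≥ c²Q³` by the TPP, the footprint `(H·Y)·(Y⁻¹·Z)` is a product set of two sets of
  size `≍ Q³` inside a set of size `O_c(Q³)`: SMALL DOUBLING at scale `Q³ = |GL₂(K)|/Q` — the entry
  point for product-set theory (Tao 2008 Thm 4.6; Breuillard–Green–Tao 2011 Thm 1.3).
* `not_subfieldCell_of_footprintExpansion` — FOOTPRINT EXPANSION → ¬ S3, where FOOTPRINT EXPANSION
  (the hypothesis, spelled inline) is the statement "balanced TPP triples `(φ(SL₂ k), Y, Z)` in
  `GL₂(K)`, `|K| = |k|²`, have footprint `> C·Q³` for `Q ≥ Q₁(c, C)`" — THEOREM F′ of the unit's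
  write-up `THEOREM-F.md`, proved there ON PAPER from Tao 2008 Thm 4.6, BGT 2011 Thm 1.3 and Dickson's
  theorem, NOT proved in Lean — and S3 is spelled verbatim in tree-only vocabulary.  Kernel-checked:
  the only non-elementary inputs of the reduction are the tree theorems above.

Sorry-free. [folklore]
-/

set_option linter.dupNamespace false

noncomputable section

open scoped BigOperators Pointwise

namespace Summit.MatrixMultiplication.MatrixMultiplication.Theorems.GradedDesignFamily.Negative

/-- **TPP from S3's separation clause.**  If `(Y, Z)` is level-one separated against `φ(SL₂ k)`
(`φ` injective) then `(φ(SL₂ k), Y, Z)` has the triple product property in `GL₂(K)`. [folklore] -/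
theorem subfieldCell_tpp {k K : Type} [Field k] [Fintype k] [DecidableEq k] [Field K]
    [Fintype K] [DecidableEq K]
    (φ : Matrix.SpecialLinearGroup (Fin 2) k →* Matrix.GeneralLinearGroup (Fin 2) K)
    (hφ : Function.Injective φ) (Y Z : Finset (Matrix.GeneralLinearGroup (Fin 2) K))
    (hsep : ∀ z₀ ∈ Z, ∃ cf : (Fin 2 → K) → (Fin 2 → K) → ℂ,
      ∀ a : Matrix.SpecialLinearGroup (Fin 2) k, ∀ y ∈ Y, ∀ y' ∈ Y, ∀ z ∈ Z,
        (∑ u : Fin 2 → K, cf u (((φ a * y * y'⁻¹ * z : Matrix.GeneralLinearGroup (Fin 2) K) :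
            Matrix (Fin 2) (Fin 2) K).mulVec u)) =
          if a = 1 ∧ y = y' ∧ z = z₀ then 1 else 0) :
    Literature.Combinatorics.Additive.TripleProductProperty (Finset.univ.image φ) Y Z := by
  have hsepX := SubfieldCell.frameSeparated_image φ hφ Y Z hsep
  refine Summit.MatrixMultiplication.MatrixMultiplication.Theorems.SepImpliesTPP_proof _
    (Set.univ : Set (Matrix.GeneralLinearGroup (Fin 2) K → ℂ)) _ Y Z ?_
  intro x₀ hx₀ z₀ hz₀
  obtain ⟨c, hc⟩ := hsepX x₀ hx₀ z₀ hz₀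
  refine ⟨fun g => ∑ u : Fin 2 → K, c u ((g : Matrix (Fin 2) (Fin 2) K).mulVec u),
    Set.mem_univ _, fun x hx y hy y' hy' z hz => ⟨fun h => ?_, fun h => ?_⟩⟩
  · exact (hc x hx y hy y' hy' z hz).trans (if_pos h)
  · exact (hc x hx y hy y' hy' z hz).trans (if_neg h)

/-- **Footprint ⊆ garbage ∪ `H·Z`.**  Every word `φ(a)·y·y'⁻¹·z` is a garbage word (`y ≠ y'`) or
lies in `φ(SL₂ k)·Z` (`y = y'`). [folklore] -/
theorem subfieldCell_footprint_subset {k K : Type} [Field k] [Fintype k] [DecidableEq k] [Field K]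
    [Fintype K] [DecidableEq K]
    (φ : Matrix.SpecialLinearGroup (Fin 2) k →* Matrix.GeneralLinearGroup (Fin 2) K)
    (Y Z : Finset (Matrix.GeneralLinearGroup (Fin 2) K)) :
    Finset.univ.image φ * Y * Y⁻¹ * Z ⊆
      ((((Finset.univ : Finset (Matrix.SpecialLinearGroup (Fin 2) k)) ×ˢ Y ×ˢ Y ×ˢ Z).filter
          fun t => t.2.1 ≠ t.2.2.1).image
        fun t => φ t.1 * t.2.1 * (t.2.2.1)⁻¹ * t.2.2.2) ∪ Finset.univ.image φ * Z := by
  intro p hp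
  obtain ⟨x, hx, z, hz, rfl⟩ := Finset.mem_mul.1 hp
  obtain ⟨x', hx', w, hw, rfl⟩ := Finset.mem_mul.1 hx
  obtain ⟨h, hh, y, hy, rfl⟩ := Finset.mem_mul.1 hx'
  obtain ⟨a, -, rfl⟩ := Finset.mem_image.1 hh
  obtain ⟨y', hy', rfl⟩ := Finset.mem_inv.1 hw
  by_cases hyy : y = y'
  · refine Finset.mem_union_right _ (Finset.mem_mul.2 ⟨φ a,
      Finset.mem_image_of_mem φ (Finset.mem_univ a), z, hz, ?_⟩)
    rw [hyy, mul_assoc (φ a) y', mul_inv_cancel, mul_one]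
  · refine Finset.mem_union_left _ (Finset.mem_image.2 ⟨(a, y, y', z), ?_, rfl⟩)
    simp [Finset.mem_filter, Finset.mem_product, hy, hy', hz, hyy]

/-- The real arithmetic of the footprint bound: from `|Γ|·(hm(Q²+Q−1) − 2Q⁴ + Q²) ≤
(Q³+Q²−hm)·Q²(Q−1)(2Q−1)(Q+1)` (confinement), `c²Q³ ≤ hm ≤ Q³+Q²`, `Q ≥ 4/c²`, `0 < c ≤ 1` and
`P ≤ |Γ| + hm` conclude `P ≤ (10/c²)·Q³`. [folklore] -/
theorem subfieldCell_footprint_arith (Q hm γ P c : ℝ) (hQ1 : 1 ≤ Q) (hc : 0 < c) (hc1 : c ≤ 1)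
    (hcQ : 4 / c ^ 2 ≤ Q) (hmlo : c ^ 2 * Q ^ 3 ≤ hm) (hceil : hm ≤ Q ^ 3 + Q ^ 2) (hγ0 : 0 ≤ γ)
    (hconf : γ * (hm * (Q ^ 2 + Q - 1) - 2 * Q ^ 4 + Q ^ 2) ≤
      (Q ^ 3 + Q ^ 2 - hm) * Q ^ 2 * (Q - 1) * (2 * Q - 1) * (Q + 1))
    (hP : P ≤ γ + hm) : P ≤ 10 / c ^ 2 * Q ^ 3 := by
  have hQ0 : 0 < Q := by linarith
  have hc2 : 0 < c ^ 2 := by positivity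
  have hc0 : c ≠ 0 := hc.ne'
  have hcQ' : 4 ≤ c ^ 2 * Q := by
    have := (div_le_iff₀ hc2).1 hcQ
    linarith
  have hm0 : 0 ≤ hm := le_trans (by positivity) hmlo
  -- the coefficient of `γ` is at least `(c²/2) Q⁵`
  have hA : c ^ 2 / 2 * Q ^ 5 ≤ hm * (Q ^ 2 + Q - 1) - 2 * Q ^ 4 + Q ^ 2 := by
    have h1 : c ^ 2 * Q ^ 3 * (Q ^ 2 + Q - 1) ≤ hm * (Q ^ 2 + Q - 1) :=
      mul_le_mul_of_nonneg_right hmlo (by nlinarith)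
    have h2 : 0 ≤ Q ^ 4 * (c ^ 2 / 2 * Q - 2) := mul_nonneg (by positivity) (by linarith)
    have h3 : 0 ≤ c ^ 2 * Q ^ 3 * (Q - 1) := mul_nonneg (by positivity) (by linarith)
    nlinarith [h1, h2, h3, sq_nonneg Q]
  -- the right-hand side is at most `4 Q⁸`
  have hD0 : 0 ≤ Q ^ 2 * (Q - 1) * (2 * Q - 1) * (Q + 1) := by
    have : 0 ≤ Q - 1 := by linarith
    have : 0 ≤ 2 * Q - 1 := by linarith
    positivity
  have hD : Q ^ 2 * (Q - 1) * (2 * Q - 1) * (Q + 1) ≤ 2 * Q ^ 5 := by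
    have e : 2 * Q ^ 5 - Q ^ 2 * (Q - 1) * (2 * Q - 1) * (Q + 1) =
        Q ^ 2 * (Q ^ 2 + 2 * Q - 1) := by ring
    have : 0 ≤ Q ^ 2 * (Q ^ 2 + 2 * Q - 1) := mul_nonneg (by positivity) (by nlinarith)
    linarith
  have hB : (Q ^ 3 + Q ^ 2 - hm) * Q ^ 2 * (Q - 1) * (2 * Q - 1) * (Q + 1) ≤ 4 * Q ^ 8 := by
    have h1 : (Q ^ 3 + Q ^ 2 - hm) * Q ^ 2 * (Q - 1) * (2 * Q - 1) * (Q + 1) ≤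
        (Q ^ 3 + Q ^ 2) * (Q ^ 2 * (Q - 1) * (2 * Q - 1) * (Q + 1)) := by
      have e : (Q ^ 3 + Q ^ 2 - hm) * Q ^ 2 * (Q - 1) * (2 * Q - 1) * (Q + 1) =
          (Q ^ 3 + Q ^ 2 - hm) * (Q ^ 2 * (Q - 1) * (2 * Q - 1) * (Q + 1)) := by ring
      rw [e]
      exact mul_le_mul_of_nonneg_right (by linarith) hD0
    have hQ32 : Q ^ 3 + Q ^ 2 ≤ 2 * Q ^ 3 := by
      nlinarith [pow_le_pow_right₀ hQ1 (show 2 ≤ 3 by norm_num)]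
    have h2 : (Q ^ 3 + Q ^ 2) * (Q ^ 2 * (Q - 1) * (2 * Q - 1) * (Q + 1)) ≤
        (2 * Q ^ 3) * (2 * Q ^ 5) := mul_le_mul hQ32 hD hD0 (by positivity)
    nlinarith [h1, h2]
  -- hence `γ ≤ 8 Q³ / c²`
  have hΓ : γ ≤ 8 / c ^ 2 * Q ^ 3 := by
    have h1 : γ * (c ^ 2 / 2 * Q ^ 5) ≤ 4 * Q ^ 8 :=
      calc γ * (c ^ 2 / 2 * Q ^ 5) ≤ γ * (hm * (Q ^ 2 + Q - 1) - 2 * Q ^ 4 + Q ^ 2) :=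
            mul_le_mul_of_nonneg_left hA hγ0
        _ ≤ _ := hconf.trans hB
    have hpos : 0 < c ^ 2 / 2 * Q ^ 5 := mul_pos (by positivity) (pow_pos hQ0 5)
    have h2 : 4 * Q ^ 8 = 8 / c ^ 2 * Q ^ 3 * (c ^ 2 / 2 * Q ^ 5) := by
      field_simp
      ring
    rw [h2] at h1
    exact le_of_mul_le_mul_right h1 hpos
  -- assemble
  have hQ23 : Q ^ 2 ≤ Q ^ 3 := pow_le_pow_right₀ hQ1 (by norm_num)
  have h2c : 2 ≤ 2 / c ^ 2 := by
    rw [le_div_iff₀ hc2]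
    nlinarith
  have h2c' : 2 * Q ^ 3 ≤ 2 / c ^ 2 * Q ^ 3 := mul_le_mul_of_nonneg_right h2c (by positivity)
  calc P ≤ γ + hm := hP
    _ ≤ 8 / c ^ 2 * Q ^ 3 + (Q ^ 3 + Q ^ 2) := add_le_add hΓ hceil
    _ ≤ 8 / c ^ 2 * Q ^ 3 + 2 / c ^ 2 * Q ^ 3 := by linarith
    _ = 10 / c ^ 2 * Q ^ 3 := by ring

/-- **The footprint bound.**  For `0 < c ≤ 1`, `|φ(SL₂ k)|, |Z| ≥ c·|K|^{3/2}`, `Y ≠ ∅` and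
`|K| ≥ 4/c²`: `|φ(SL₂ k)·Y·Y⁻¹·Z| ≤ (10/c²)·|K|³` — from the lead's garbage confinement
`subfieldCell_confinement` (`|Γ| ≤ 8|K|³/c²`) and the standing ceiling `subfieldCell_ceiling`
(`|φ(SL₂ k)||Z| ≤ |K|³ + |K|²`). [folklore] -/
theorem subfieldCell_footprint_card_le {k K : Type} [Field k] [Fintype k] [DecidableEq k] [Field K]
    [Fintype K] [DecidableEq K]
    (φ : Matrix.SpecialLinearGroup (Fin 2) k →* Matrix.GeneralLinearGroup (Fin 2) K)
    (hφ : Function.Injective φ) (Y Z : Finset (Matrix.GeneralLinearGroup (Fin 2) K))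
    (hsep : ∀ z₀ ∈ Z, ∃ cf : (Fin 2 → K) → (Fin 2 → K) → ℂ,
      ∀ a : Matrix.SpecialLinearGroup (Fin 2) k, ∀ y ∈ Y, ∀ y' ∈ Y, ∀ z ∈ Z,
        (∑ u : Fin 2 → K, cf u (((φ a * y * y'⁻¹ * z : Matrix.GeneralLinearGroup (Fin 2) K) :
            Matrix (Fin 2) (Fin 2) K).mulVec u)) =
          if a = 1 ∧ y = y' ∧ z = z₀ then 1 else 0)
    (c : ℝ) (hc : 0 < c) (hc1 : c ≤ 1)
    (hH : c * (Fintype.card K : ℝ) ^ (3 / 2 : ℝ) ≤ (Finset.univ.image φ).card)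
    (hY : Y.Nonempty) (hZ : c * (Fintype.card K : ℝ) ^ (3 / 2 : ℝ) ≤ Z.card)
    (hQ : 4 / c ^ 2 ≤ (Fintype.card K : ℝ)) :
    ((Finset.univ.image φ * Y * Y⁻¹ * Z).card : ℝ) ≤ 10 / c ^ 2 * (Fintype.card K : ℝ) ^ 3 := by
  have hQ1 : (1 : ℝ) ≤ (Fintype.card K : ℝ) := Nat.one_le_cast.2 Fintype.card_pos
  have hQ0 : (0 : ℝ) < (Fintype.card K : ℝ) := by linarith
  have hs2 : ((Fintype.card K : ℝ) ^ (3 / 2 : ℝ)) ^ 2 = (Fintype.card K : ℝ) ^ 3 := by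
    rw [sq, ← Real.rpow_add hQ0]
    norm_num
  -- `Z ≠ ∅`
  have hZne : Z.Nonempty := by
    rw [← Finset.card_pos]
    have hpos : (0 : ℝ) < (Fintype.card K : ℝ) ^ (3 / 2 : ℝ) := Real.rpow_pos_of_pos hQ0 _
    have : (0 : ℝ) < Z.card := lt_of_lt_of_le (mul_pos hc hpos) hZ
    exact_mod_cast this
  -- `|H||Z| ≥ c² Q³`
  have hm : c ^ 2 * (Fintype.card K : ℝ) ^ 3 ≤ ((Finset.univ.image φ).card : ℝ) * Z.card := by
    have h := mul_le_mul hH hZ (by positivity) (by positivity)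
    calc c ^ 2 * (Fintype.card K : ℝ) ^ 3
        = c * (Fintype.card K : ℝ) ^ (3 / 2 : ℝ) * (c * (Fintype.card K : ℝ) ^ (3 / 2 : ℝ)) := by
          rw [← hs2]; ring
      _ ≤ _ := h
  -- `|H||Z| ≤ Q³ + Q²` (standing ceiling)
  have hceilN := subfieldCell_ceiling φ hφ Y Z hY hZne hsep
  have hceil : ((Finset.univ.image φ).card : ℝ) * Z.card ≤
      (Fintype.card K : ℝ) ^ 3 + (Fintype.card K : ℝ) ^ 2 := by
    have h' : (Finset.univ.image φ).card * Z.card ≤ Fintype.card K ^ 3 + Fintype.card K ^ 2 :=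
      le_trans (Nat.le_add_right _ _) hceilN
    exact_mod_cast h'
  -- garbage confinement (lead c8) and the footprint count
  have hconf := subfieldCell_confinement φ hφ Y Z hY hsep
  have hsub := subfieldCell_footprint_subset φ Y Z
  have hcardN := (Finset.card_le_card hsub).trans ((Finset.card_union_le _ _).trans
    (Nat.add_le_add_left Finset.card_mul_le _))
  have hP := (Nat.cast_le (α := ℝ)).2 hcardN
  push_cast at hP
  exact subfieldCell_footprint_arith _ _ _ _ c hQ1 hc hc1 hQ hm hceil (Nat.cast_nonneg _) hconf hP

/-- **S3 is refuted by FOOTPRINT EXPANSION** (THEOREM F′ of the unit's write-up, the hypothesis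
`hF`; OPEN in Lean).  `hF` says: for all `c, C > 0` there is `Q₁` such that for every finite field
`k`, every field `K` with `|K| = |k|² ≥ Q₁`, every injective `φ : SL₂(k) →* GL₂(K)` and all
`Y, Z ⊆ GL₂(K)` with `|φ(SL₂ k)|, |Y|, |Z| ≥ c|K|^{3/2}` and the triple product property of
`(φ(SL₂ k), Y, Z)`, the footprint satisfies `|φ(SL₂ k)·Y·Y⁻¹·Z| > C|K|³`.  Its paper proof
(THEOREM-F.md, gen 18): balanced factorisation `(φ(SL₂ k)·Y)·(Y⁻¹·Z)`, Tao 2008 Thm 4.6 (an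
`O_{c,C}(1)`-approximate group of size `≍ |K|³` controlling both factors), Breuillard–Green–Tao 2011
Thm 1.3 in `SL₂(K)` + Dickson (the approximate group meets `O(1)` cosets of `SL₂(K)` or lies in a
Borel), and the two dead ends `detSpread_card_mul_le` / "`SL₂(k)` is not covered by `O(1)` Borel
cosets"; deciding it in Lean needs the two external theorems as Literature facts.  CONCLUSION:
`¬ stub_subfieldCell` (S3 spelled verbatim in tree-only vocabulary).  The reduction is kernel-checked;
NOT summit progress. [cite: Tao2006, Thm 4.6; BreuillardGreenTao2011, Thm 1.3] -/
theorem not_subfieldCell_of_footprintExpansion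
    (hF : ∀ c C : ℝ, 0 < c → 0 < C → ∃ Q₁ : ℕ, ∀ (k K : Type) [Field k] [Fintype k] [DecidableEq k]
      [Field K] [Fintype K] [DecidableEq K]
      (φ : Matrix.SpecialLinearGroup (Fin 2) k →* Matrix.GeneralLinearGroup (Fin 2) K),
      Function.Injective φ → Fintype.card K = Fintype.card k ^ 2 → Q₁ ≤ Fintype.card K →
      ∀ Y Z : Finset (Matrix.GeneralLinearGroup (Fin 2) K),
        c * (Fintype.card K : ℝ) ^ (3 / 2 : ℝ) ≤ (Finset.univ.image φ).card →
        c * (Fintype.card K : ℝ) ^ (3 / 2 : ℝ) ≤ Y.card →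
        c * (Fintype.card K : ℝ) ^ (3 / 2 : ℝ) ≤ Z.card →
        Literature.Combinatorics.Additive.TripleProductProperty (Finset.univ.image φ) Y Z →
        C * (Fintype.card K : ℝ) ^ 3 < ((Finset.univ.image φ * Y * Y⁻¹ * Z).card : ℝ)) :
    ¬ (∃ c : ℝ, 0 < c ∧ ∀ N : ℕ, ∃ (k K : Type) (_ : Field k) (_ : Fintype k) (_ : DecidableEq k)
      (_ : Field K) (_ : Fintype K) (_ : DecidableEq K)
      (φ : Matrix.SpecialLinearGroup (Fin 2) k →* Matrix.GeneralLinearGroup (Fin 2) K),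
      Function.Injective φ ∧ Fintype.card K = Fintype.card k ^ 2 ∧ N ≤ Fintype.card K ∧
      ∃ Y Z : Finset (Matrix.GeneralLinearGroup (Fin 2) K),
        c * (Fintype.card K : ℝ) ^ (3 / 2 : ℝ) ≤ (Finset.univ.image φ).card ∧
        c * (Fintype.card K : ℝ) ^ (3 / 2 : ℝ) ≤ Y.card ∧
        c * (Fintype.card K : ℝ) ^ (3 / 2 : ℝ) ≤ Z.card ∧
        ∀ z₀ ∈ Z, ∃ cf : (Fin 2 → K) → (Fin 2 → K) → ℂ,
          ∀ a : Matrix.SpecialLinearGroup (Fin 2) k, ∀ y ∈ Y, ∀ y' ∈ Y, ∀ z ∈ Z,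
            (∑ u : Fin 2 → K, cf u (((φ a * y * y'⁻¹ * z : Matrix.GeneralLinearGroup (Fin 2) K) :
                Matrix (Fin 2) (Fin 2) K).mulVec u)) =
              if a = 1 ∧ y = y' ∧ z = z₀ then 1 else 0) := by
  rintro ⟨c, hc, hS⟩
  set c' : ℝ := min c 1 with hc'def
  have hc' : 0 < c' := lt_min hc one_pos
  have hc'1 : c' ≤ 1 := min_le_right _ _
  have hc'c : c' ≤ c := min_le_left _ _
  obtain ⟨Q₁, hQ₁⟩ := hF c' (10 / c' ^ 2) hc' (div_pos (by norm_num) (pow_pos hc' 2))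
  obtain ⟨k, K, _, _, _, _, _, _, φ, hφ, hK, hN, Y, Z, hH, hY, hZ, hsep⟩ :=
    hS (max Q₁ ⌈(4 : ℝ) / c' ^ 2⌉₊)
  have hs0 : (0 : ℝ) ≤ (Fintype.card K : ℝ) ^ (3 / 2 : ℝ) := by positivity
  have hH' : c' * (Fintype.card K : ℝ) ^ (3 / 2 : ℝ) ≤ (Finset.univ.image φ).card :=
    (mul_le_mul_of_nonneg_right hc'c hs0).trans hH
  have hY' : c' * (Fintype.card K : ℝ) ^ (3 / 2 : ℝ) ≤ Y.card :=
    (mul_le_mul_of_nonneg_right hc'c hs0).trans hY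
  have hZ' : c' * (Fintype.card K : ℝ) ^ (3 / 2 : ℝ) ≤ Z.card :=
    (mul_le_mul_of_nonneg_right hc'c hs0).trans hZ
  have hQ1 : Q₁ ≤ Fintype.card K := (le_max_left _ _).trans hN
  have hQ4 : (4 : ℝ) / c' ^ 2 ≤ (Fintype.card K : ℝ) :=
    Nat.ceil_le.1 ((le_max_right _ _).trans hN)
  have hYne : Y.Nonempty := by
    rw [← Finset.card_pos]
    have hpos : (0 : ℝ) < (Fintype.card K : ℝ) ^ (3 / 2 : ℝ) :=
      Real.rpow_pos_of_pos (by exact_mod_cast Fintype.card_pos) _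
    have : (0 : ℝ) < Y.card := lt_of_lt_of_le (mul_pos hc' hpos) hY'
    exact_mod_cast this
  have htpp := subfieldCell_tpp φ hφ Y Z hsep
  have hle := subfieldCell_footprint_card_le φ hφ Y Z hsep c' hc' hc'1 hH' hYne hZ' hQ4
  have hlt := hQ₁ k K φ hφ hK hQ1 Y Z hH' hY' hZ' htpp
  exact absurd (hlt.trans_le hle) (lt_irrefl _)

end Summit.MatrixMultiplication.MatrixMultiplication.Theorems.GradedDesignFamily.Negative

end
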